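/-
Copyright (c) 2026 the pub-hodgecm-mathlib formalisation cell (harness21).  Prover seat hodgecm-mathlib-K2E3-p14 (g7), Track B «K2-LIT» ∕ h413
(`stmt-HodgeConjecture-24833`), line `K2_E3_EllipticInputs`, PART «RANK» (qs2-ps) «van Dijk₂» (cut K2E3-p21 (g7)), brick D118 (WEYL₂), stage (WEYL₂-rad) = W2-1:
the RADIAL Weyl integration formula on the hyperbolic set of `U(1,1) = U(Φ₂)(L⁺_v)` — the `N = 2` port, token for token, of ★ LH2-p02 (g3)'s `F0P3cStCharTSWeylHypMeasure` §3.
2026-09-04.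
-/
import Summits.HodgeConjecture.HodgeConjecture.Theorems.F0P3cStCharTSWeylHypMeasure      -- ★ (N = 3 template) §1 `isOpen_setOf_isRegularElt_torusU` (any `N`), §2 `map_prod_eq_smul_restrict_of_lintegral_radial`, `integrable_and_integral_eq_smul_of_lintegral_radial` (generic); brings ★ WeylHypCM (`isUnit_of_ne_zero_of_nonsplit`, `sub_ne_zero_of_valued_ne`, `isUnit_of_forall_apply_ne_zero`), ★ TorusRay `exists_uniformizer_units`, ★ `v_conjLocal_apply`
import Summits.HodgeConjecture.HodgeConjecture.Theorems.F0P3cStCharTSUpTrU2Norm         -- ★ (JAC-LOC₂ (B4)) `index_torusU_subgroupOf_normalizer_two_eq_two`, `exists_mem_torusU_isRegularElt_two`, `forall_mem_torusU_mul_comm`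
import HarnessLib

/-!
# K2_E3 road (h413), PART «RANK» (qs2-ps), brick (WEYL₂-rad) W2-1 — the Weyl integration formula on the hyperbolic set of `U(1,1) = U(Φ₂)(L⁺_v)`, RADIAL FORM

Cell `pub/hodgecm-mathlib` (D-0151), Track B, seat K2E3-p14 (g7); dealer K2E3-plan (g4) D118 (13:33:49Z); census 13:34:53Z ∕ 13:38:14Z (the Jacobian half of (WEYL₂) is
★ as the «JAC-LOC₂» sub-road; this is the first of the four `3 ↦ 2` ports W2-1…W2-4).  `--supports stmt-HodgeConjecture-24833 --as helper`; THEOREMS ONLY; never imports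
`Cruxes/…/Lines`.  COUNT-NEUTRAL.

THE MATHEMATICS.  `v` a NON-SPLIT finite place of `L⁺`, `G₂ = U(Φ₂)(L⁺_v)` (the matrix carrier `↥(unitaryGroupOfForm (conjLocal L c v) (cmLocalForm L 2 v))`),
`T₂ = (cmBorelTriple L 2 v).M` its diagonal torus (`= torusU`, `rfl`), `Ω₂ = ⋃_g g T₂^{reg} g⁻¹` the hyperbolic set, `Φ(xT₂, t) = x t x⁻¹`.  ★ Literature
`exists_radialMeasure_lintegral_conjFamily` (Harish-Chandra 1970 L. 42 ∕ Weil 1965 n° 49, Jacobian-free) is instantiated with every hypothesis discharged BY NAME at `N = 2`: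
`T₂` closed (`isClosed_cmBorelTriple_M_two`, the two off-diagonal entries), abelian (★ `forall_mem_torusU_mul_comm`), `|N(T₂)∕T₂| = 2` (★ JAC-LOC₂ (B4)
`index_torusU_subgroupOf_normalizer_two_eq_two` over a regular element `exists_mem_torusU_isRegularElt_two_cm`: `d(α, α⁻¹)`, `α = ϖ·σ(ϖ)`, `v_w(α) = q⁻² ≠ v_w(α⁻¹)`),
centralisers of regular elements of `T₂` equal `T₂` (★ (A1) `centralizer_eq_torusU_of_isRegularElt`, any `N`), local injectivity of `Φ` on the regular part (★
`exists_isOpen_injOn_conjFamily`), `Ω₂` Borel (Lusin–Souslin ★ `measurableSet_image_inter_of_locallyInjOn`, `T₂^{reg}` open ★ `isOpen_setOf_isRegularElt_torusU`).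
* **`exists_radialMeasure_lintegral_hypSet_two`** — `∃ σ` on `T₂` (finite on compacts, σ-finite, carried by `T₂^{reg}`) with **`2 · ∫⁻_{Ω₂} f dν = ∫⁻_{T₂} ∫⁻_{G₂⧸T₂} f(Φ(q,t)) d(ν∕tm) dσ`**;
* **`exists_radialMeasure_integral_hypSet_two`** — the same `σ` with the measure form `(σ ⊗ (ν∕tm)) ∘ Φ̃⁻¹ = 2 · ν|_{Ω₂}` and the ℂ-valued Bochner form.
Classically `dσ = |D₂(t)| dtm` — that identification (W2-3, from ★ `tubeJacobianLocal_splitCartan_U2`) is NOT asserted here.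
[Rogawski1990, §12.5 p. 182] [HarishChandra1970, Lemma 42] [Weil1965, n° 49 Lemme 22] [vanDijk1972, §2]
HONEST LABEL: HC_CM is proved only modulo the 7 printed citations (2 remaining named inputs: hLiu418 = stmt-HodgeConjecture-24832, h413 = stmt-HodgeConjecture-24833)
until rung 0 closes; count-neutral helper of the (WEYL₂) line (W2-2 WIF₂, W2-3 density, W2-4 measurable form remain).

## References
* [Rogawski1990] J. D. Rogawski, *Automorphic Representations of Unitary Groups in Three Variables*, Ann. of Math. Stud. 123 (1990), §12.5 p. 182.
* [HarishChandra1970] Harish-Chandra (van Dijk), *Harmonic Analysis on Reductive p-adic Groups*, LNM 162 (1970), Lemma 42.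
* [Weil1965] A. Weil, *Sur la formule de Siegel dans la théorie des groupes classiques*, Acta Math. 113 (1965), n° 49 Lemme 22.
* [vanDijk1972] G. van Dijk, *Computation of certain induced characters of p-adic groups*, Math. Ann. 199 (1972), §2.
-/

set_option autoImplicit false
set_option linter.dupNamespace false

open MeasureTheory Measure Set Filter Topology Function NumberField IsDedekindDomain Matrix Polynomial
open Literature.MeasureTheory.Group
open Literature.NumberTheory.Automorphic Literature.NumberTheory.Automorphic.UnitaryGroup Literature.NumberTheory.Rogawski1990
open Summit.HodgeConjecture.HodgeConjecture.Cruxes.H413.F0P3cStCharTSWeylHypFibre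
open Summit.HodgeConjecture.HodgeConjecture.Cruxes.H413.F0P3cStCharTSWeylHypTorsor
open Summit.HodgeConjecture.HodgeConjecture.Cruxes.H413.F0P3cStCharTSWeylHypCM
open Summit.HodgeConjecture.HodgeConjecture.Cruxes.H413.F0P3cStCharTSWeylHypMeasure
open Summit.HodgeConjecture.HodgeConjecture.Cruxes.H413
open scoped ENNReal NNReal MatrixGroups Pointwise

namespace Summit.HodgeConjecture.HodgeConjecture.Cruxes.H413.K2E3QuasiSplitTwoWeylRadial

variable (L : Type) [Field L] [NumberField L] [IsCMField L] (v : HeightOneSpectrum (𝓞 ↥(maximalRealSubfield L)))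

/-! ## §1 The two `N = 2` inputs not yet in the tree: `T₂` is closed; a regular element of `T₂` -/

/-- **The diagonal torus `T₂ = (cmBorelTriple L 2 v).M` is closed in `U(Φ₂)(L⁺_v)`** (the vanishing of the two continuous off-diagonal entries; ★
`mem_range_glDiagonal_iff_isDiag`; the `N = 3` twin is ★ `isClosed_cmBorelTriple_M`). [cite: Rogawski1990, §1.10 p. 9] -/
theorem isClosed_cmBorelTriple_M_two :
    IsClosed (((cmBorelTriple L 2 v).M : Subgroup ↥(unitaryGroupOfForm (conjLocal L (IsCMField.complexConj L) v) (cmLocalForm L 2 v))) :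
      Set ↥(unitaryGroupOfForm (conjLocal L (IsCMField.complexConj L) v) (cmLocalForm L 2 v))) := by
  have hcont : ∀ i j : Fin 2, Continuous fun g : ↥(unitaryGroupOfForm (conjLocal L (IsCMField.complexConj L) v) (cmLocalForm L 2 v)) =>
      (g : GL (Fin 2) (UnitaryGroup.LocalRing L v)) i j := fun i j =>
    ((Units.continuous_val.comp continuous_subtype_val).matrix_elem i j)
  have hset : (((cmBorelTriple L 2 v).M : Subgroup ↥(unitaryGroupOfForm (conjLocal L (IsCMField.complexConj L) v) (cmLocalForm L 2 v))) :
      Set ↥(unitaryGroupOfForm (conjLocal L (IsCMField.complexConj L) v) (cmLocalForm L 2 v))) =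
      ⋂ i : Fin 2, ⋂ j : Fin 2, {g : ↥(unitaryGroupOfForm (conjLocal L (IsCMField.complexConj L) v) (cmLocalForm L 2 v)) |
        i ≠ j → (g : GL (Fin 2) (UnitaryGroup.LocalRing L v)) i j = 0} := by
    ext g
    simp only [Set.mem_iInter, Set.mem_setOf_eq, SetLike.mem_coe]
    exact (mem_range_glDiagonal_iff_isDiag (g : GL (Fin 2) (UnitaryGroup.LocalRing L v))).trans
      ⟨fun h i j hij => h hij, fun h i j hij => h i j hij⟩
  rw [hset]
  refine isClosed_iInter fun i => isClosed_iInter fun j => ?_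
  by_cases hij : i ≠ j
  · have : {g : ↥(unitaryGroupOfForm (conjLocal L (IsCMField.complexConj L) v) (cmLocalForm L 2 v)) |
        i ≠ j → (g : GL (Fin 2) (UnitaryGroup.LocalRing L v)) i j = 0} =
        (fun g : ↥(unitaryGroupOfForm (conjLocal L (IsCMField.complexConj L) v) (cmLocalForm L 2 v)) =>
          (g : GL (Fin 2) (UnitaryGroup.LocalRing L v)) i j) ⁻¹' {0} := by
      ext g; simp [hij]
    rw [this]
    exact isClosed_singleton.preimage (hcont i j)
  · have : {g : ↥(unitaryGroupOfForm (conjLocal L (IsCMField.complexConj L) v) (cmLocalForm L 2 v)) |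
        i ≠ j → (g : GL (Fin 2) (UnitaryGroup.LocalRing L v)) i j = 0} = Set.univ := by
      ext g; simp [hij]
    rw [this]
    exact isClosed_univ

/-- **A regular element of the diagonal torus of `U(Φ₂)(L⁺_v)`, `v` non-split**: `d(α, α⁻¹)` with `α = ϖ · σ(ϖ)` (`σ`-fixed; `v_w(α) = q⁻²`, `v_w(α⁻¹) = q²`, so `α − α⁻¹`
is a unit of the field-like `L_w`) — ★ JAC-LOC₂ (B4) `exists_mem_torusU_isRegularElt_two` with this `α`.  (`N = 3` twin: ★ `exists_mem_torusU_isRegularElt`.)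
[cite: Rogawski1990, §12.5 p. 182; §3.1 p. 19] -/
theorem exists_mem_torusU_isRegularElt_two_cm (hns : ∀ w : PlacesOver L v, IsCMField.complexConj L • w.1 = w.1) :
    ∃ m : ↥(unitaryGroupOfForm (conjLocal L (IsCMField.complexConj L) v) (cmLocalForm L 2 v)),
      m ∈ torusU (conjLocal L (IsCMField.complexConj L) v) (cmLocalForm L 2 v) ∧ IsRegularElt (m : GL (Fin 2) (LocalRing L v)) := by
  haveI : Algebra.IsQuadraticExtension ↥(maximalRealSubfield L) L := IsCMField.isQuadraticExtension L
  obtain ⟨w₀⟩ := (inferInstance : Nonempty (PlacesOver L v))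
  haveI := PlacesOver.subsingleton_of_smul_eq (IsCMField.complexConj L) (IsCMField.complexConj_ne_one L) w₀ (hns w₀)
  have hR : ∀ x : LocalRing L v, x ≠ 0 → IsUnit x := isUnit_of_ne_zero_of_nonsplit L v hns
  obtain ⟨ϖ, hϖ⟩ := F0P3cStCharTSTorusRay.exists_uniformizer_units L v
  set σ : LocalRing L v →+* LocalRing L v := conjLocal L (IsCMField.complexConj L) v with hσ
  -- `α = ϖ · σ(ϖ)`, a `σ`-fixed unit
  set ϖσ : (LocalRing L v)ˣ := Units.map (σ : LocalRing L v →* LocalRing L v) ϖ with hϖσ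
  set α : (LocalRing L v)ˣ := ϖ * ϖσ with hα
  have hασ : σ (α : LocalRing L v) = α := by
    rw [hα, Units.val_mul, map_mul, hϖσ, Units.coe_map, MonoidHom.coe_coe, hσ, conjLocal_conjLocal_cm, mul_comm]
  -- valuations at every place: `v(α) = exp(-2)`, `v(α⁻¹) = exp 2`
  have hvα : ∀ w : PlacesOver L v, Valued.v ((α : LocalRing L v) w) = WithZero.exp (-2 : ℤ) := fun w => by
    rw [hα, Units.val_mul, Pi.mul_apply, map_mul, hϖ, hϖσ, Units.coe_map, MonoidHom.coe_coe, hσ, v_conjLocal_apply, hϖ, ← WithZero.exp_add]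
    norm_num
  have hvαinv : ∀ w : PlacesOver L v, Valued.v (((α⁻¹ : (LocalRing L v)ˣ) : LocalRing L v) w) = WithZero.exp (2 : ℤ) := fun w => by
    have h1 : ((α⁻¹ : (LocalRing L v)ˣ) : LocalRing L v) w = (((α : (LocalRing L v)ˣ) : LocalRing L v) w)⁻¹ := by
      have e : ((α⁻¹ : (LocalRing L v)ˣ) : LocalRing L v) w * ((α : (LocalRing L v)ˣ) : LocalRing L v) w = 1 := by
        rw [← Pi.mul_apply, Units.inv_mul, Pi.one_apply]
      exact eq_inv_of_mul_eq_one_left e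
    rw [h1, map_inv₀, hvα, ← WithZero.exp_neg, neg_neg]
  have hne : WithZero.exp (-2 : ℤ) ≠ WithZero.exp (2 : ℤ) := fun h => by have := WithZero.exp_injective h; omega
  have hu : IsUnit ((α : LocalRing L v) - ((α⁻¹ : (LocalRing L v)ˣ) : LocalRing L v)) := by
    refine isUnit_of_forall_apply_ne_zero L v _ fun w => ?_
    rw [Pi.sub_apply]
    refine sub_ne_zero_of_valued_ne L v ?_
    rw [hvα, hvαinv]; exact hne
  exact F0P3cStCharTSUpTrU2Norm.exists_mem_torusU_isRegularElt_two σ (cmLocalForm_eq_over L 2 v) α hασ hu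

/-! ## §2 The radial Weyl integration formula on the hyperbolic set of `U(Φ₂)(L⁺_v)` -/

set_option maxHeartbeats 400000 in
/-- **THE WEYL INTEGRATION FORMULA ON THE HYPERBOLIC SET OF `U(Φ₂)(L⁺_v) = U(1,1)`, RADIAL FORM (UNCONDITIONAL).**  `v` a non-split finite place of `L⁺`,
`G₂ = U(Φ₂)(L⁺_v)` (matrix carrier), `T₂ = (cmBorelTriple L 2 v).M` its split diagonal torus, `ν` a Haar measure on `G`, `tm` a Haar measure on `T`, `Φ(xT, t) = x t x⁻¹`
the conjugation family, `Ω = ⋃_g g T^{reg} g⁻¹` the hyperbolic set (★ (B1)'s shape).  There is a measure `σ` on `T`, finite on compact sets, σ-finite and CARRIED BY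
`T^{reg}`, such that for every Borel `f ≥ 0` on `G`
**`2 · ∫⁻_Ω f dν = ∫⁻_T ∫⁻_{G ⧸ T} f(Φ(q, t)) d(ν∕tm)(q) dσ(t)`**, `ν∕tm` = ★ `quotientMeasure` — ★ `exists_radialMeasure_lintegral_conjFamily` with «regular set»
`R := Ω`, every hypothesis discharged by name (see the module docstring); `2 = |N(T)∕T|` (§1).  Classically `dσ = |D_G(t)| dtm(t)`; that identification (the
Jacobian of conjugation) is NOT asserted here.  The three topological instance arguments are the ★ `locallyCompactSpace_local` ∕ `secondCountableTopology_local` ∕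
`t2Space_cmDatum_local` terms at the call site. [cite: Rogawski1990, §12.5 p. 182] [cite: HarishChandra1970, Lemma 42] [cite: Weil1965, n° 49 Lemme 22 (p. 70)]
[cite: vanDijk1972, §2] -/
theorem exists_radialMeasure_lintegral_hypSet_two
    (hns : ∀ w : PlacesOver L v, IsCMField.complexConj L • w.1 = w.1)
    [MeasurableSpace ↥(unitaryGroupOfForm (conjLocal L (IsCMField.complexConj L) v) (cmLocalForm L 2 v))]
    [BorelSpace ↥(unitaryGroupOfForm (conjLocal L (IsCMField.complexConj L) v) (cmLocalForm L 2 v))]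
    [LocallyCompactSpace ↥(unitaryGroupOfForm (conjLocal L (IsCMField.complexConj L) v) (cmLocalForm L 2 v))]
    [SecondCountableTopology ↥(unitaryGroupOfForm (conjLocal L (IsCMField.complexConj L) v) (cmLocalForm L 2 v))]
    [T2Space ↥(unitaryGroupOfForm (conjLocal L (IsCMField.complexConj L) v) (cmLocalForm L 2 v))]
    [MeasurableSpace (↥(unitaryGroupOfForm (conjLocal L (IsCMField.complexConj L) v) (cmLocalForm L 2 v)) ⧸ (cmBorelTriple L 2 v).M)]
    [BorelSpace (↥(unitaryGroupOfForm (conjLocal L (IsCMField.complexConj L) v) (cmLocalForm L 2 v)) ⧸ (cmBorelTriple L 2 v).M)]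
    (ν : Measure ↥(unitaryGroupOfForm (conjLocal L (IsCMField.complexConj L) v) (cmLocalForm L 2 v)))
    [ν.IsHaarMeasure] [ν.IsMulRightInvariant]
    (tm : Measure ↥(cmBorelTriple L 2 v).M) [tm.IsMulLeftInvariant] [IsFiniteMeasureOnCompacts tm] [tm.IsOpenPosMeasure]
    [tm.IsInvInvariant]
    (Φ : (↥(unitaryGroupOfForm (conjLocal L (IsCMField.complexConj L) v) (cmLocalForm L 2 v)) ⧸ (cmBorelTriple L 2 v).M) ×
        ↥(cmBorelTriple L 2 v).M → ↥(unitaryGroupOfForm (conjLocal L (IsCMField.complexConj L) v) (cmLocalForm L 2 v)))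
    (hΦ : ∀ (x : ↥(unitaryGroupOfForm (conjLocal L (IsCMField.complexConj L) v) (cmLocalForm L 2 v))) (t : ↥(cmBorelTriple L 2 v).M),
      Φ (QuotientGroup.mk x, t) = x * t * x⁻¹) :
    ∃ σ : Measure ↥(cmBorelTriple L 2 v).M, IsFiniteMeasureOnCompacts σ ∧ SigmaFinite σ ∧
      σ {t : ↥(cmBorelTriple L 2 v).M |
          ¬ IsRegularElt (((t : ↥(unitaryGroupOfForm (conjLocal L (IsCMField.complexConj L) v) (cmLocalForm L 2 v))) :
            GL (Fin 2) (LocalRing L v)))} = 0 ∧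
      ∀ f : ↥(unitaryGroupOfForm (conjLocal L (IsCMField.complexConj L) v) (cmLocalForm L 2 v)) → ℝ≥0∞, Measurable f →
        2 * ∫⁻ y in {x | ∃ g t : ↥(unitaryGroupOfForm (conjLocal L (IsCMField.complexConj L) v) (cmLocalForm L 2 v)),
                t ∈ (cmBorelTriple L 2 v).M ∧ IsRegularElt (t : GL (Fin 2) (LocalRing L v)) ∧ g * t * g⁻¹ = x}, f y ∂ν =
          ∫⁻ t, ∫⁻ q, f (Φ (q, t)) ∂(quotientMeasure (cmBorelTriple L 2 v).M tm (isClosed_cmBorelTriple_M_two L v) ν) ∂σ := by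
  classical
  -- §a the field-like local ring at the non-split place, the split form `Φ₃`, a regular element of `T` (★ (B0))
  haveI : Nontrivial (LocalRing L v) := UnitaryGroup.nontrivial_localRing L v
  have hR : ∀ x : LocalRing L v, x ≠ 0 → IsUnit x := isUnit_of_ne_zero_of_nonsplit L v hns
  have hJ : cmLocalForm L 2 v = (StdForm.antidiagonal 2).over (LocalRing L v) := cmLocalForm_eq_over L 2 v
  have hex := exists_mem_torusU_isRegularElt_two_cm L v hns
  -- §b `T` is closed and abelian with Weyl group of order `2`; centralisers of regular elements of `T` are `T`
  have hT := isClosed_cmBorelTriple_M_two L v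
  have hTc : ∀ a ∈ (cmBorelTriple L 2 v).M, ∀ b ∈ (cmBorelTriple L 2 v).M, a * b = b * a :=
    F0P3cStCharTSUpTrU2Norm.forall_mem_torusU_mul_comm (conjLocal L (IsCMField.complexConj L) v)
  have hW : (((cmBorelTriple L 2 v).M).subgroupOf
      (Subgroup.normalizer (((cmBorelTriple L 2 v).M : Subgroup ↥(unitaryGroupOfForm (conjLocal L (IsCMField.complexConj L) v) (cmLocalForm L 2 v))) : Set ↥(unitaryGroupOfForm (conjLocal L (IsCMField.complexConj L) v) (cmLocalForm L 2 v))))).index = 2 :=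
    F0P3cStCharTSUpTrU2Norm.index_torusU_subgroupOf_normalizer_two_eq_two (conjLocal L (IsCMField.complexConj L) v) hR hJ hex
  have hW0 := ne_of_eq_of_ne hW two_ne_zero
  -- §c the machinery of ★ `ConjugationFamilyFibres` ∕ `FibreCountPullback`: `Φ` continuous, locally injective on the regular part `D₀`
  haveI : PolishSpace ((↥(unitaryGroupOfForm (conjLocal L (IsCMField.complexConj L) v) (cmLocalForm L 2 v)) ⧸ (cmBorelTriple L 2 v).M) × ↥(cmBorelTriple L 2 v).M) :=
    polishSpace_quotient_prod_subgroup (cmBorelTriple L 2 v).M hT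
  have hΦc : Continuous Φ := (continuous_conjFamily_and_smul (cmBorelTriple L 2 v).M Φ hΦ).1
  haveI : SecondCountableTopology ↥(cmBorelTriple L 2 v).M := TopologicalSpace.Subtype.secondCountableTopology _
  haveI : BorelSpace ((↥(unitaryGroupOfForm (conjLocal L (IsCMField.complexConj L) v) (cmLocalForm L 2 v)) ⧸ (cmBorelTriple L 2 v).M) × ↥(cmBorelTriple L 2 v).M) := Prod.borelSpace
  have hD₀ : MeasurableSet {p : (↥(unitaryGroupOfForm (conjLocal L (IsCMField.complexConj L) v) (cmLocalForm L 2 v)) ⧸ (cmBorelTriple L 2 v).M) × ↥(cmBorelTriple L 2 v).M |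
      IsRegularElt (((p.2 : ↥(unitaryGroupOfForm (conjLocal L (IsCMField.complexConj L) v) (cmLocalForm L 2 v)))) : GL (Fin 2) (LocalRing L v))} :=
    (isOpen_setOf_isRegularElt_torusU (conjLocal L (IsCMField.complexConj L) v) (cmLocalForm L 2 v) hR).measurableSet.preimage
      measurable_snd
  have hinj : ∀ z ∈ {p : (↥(unitaryGroupOfForm (conjLocal L (IsCMField.complexConj L) v) (cmLocalForm L 2 v)) ⧸ (cmBorelTriple L 2 v).M) × ↥(cmBorelTriple L 2 v).M |
      IsRegularElt (((p.2 : ↥(unitaryGroupOfForm (conjLocal L (IsCMField.complexConj L) v) (cmLocalForm L 2 v)))) : GL (Fin 2) (LocalRing L v))},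
      ∃ U : Set ((↥(unitaryGroupOfForm (conjLocal L (IsCMField.complexConj L) v) (cmLocalForm L 2 v)) ⧸ (cmBorelTriple L 2 v).M) × ↥(cmBorelTriple L 2 v).M), IsOpen U ∧ z ∈ U ∧
        InjOn Φ (U ∩ {p | IsRegularElt (((p.2 : ↥(unitaryGroupOfForm (conjLocal L (IsCMField.complexConj L) v) (cmLocalForm L 2 v)))) : GL (Fin 2) (LocalRing L v))}) := fun z _ =>
    exists_isOpen_injOn_conjFamily (cmBorelTriple L 2 v).M hT hTc Φ hΦ
      {x : ↥(unitaryGroupOfForm (conjLocal L (IsCMField.complexConj L) v) (cmLocalForm L 2 v)) | IsRegularElt (x : GL (Fin 2) (LocalRing L v))} (fun t ht => centralizer_eq_torusU_of_isRegularElt (conjLocal L (IsCMField.complexConj L) v) (cmLocalForm L 2 v) t.2 ht) hW0 z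
  -- §d the hyperbolic set is the image of `D₀`, hence Borel (Lusin–Souslin)
  have hΩeq : Φ '' {p : (↥(unitaryGroupOfForm (conjLocal L (IsCMField.complexConj L) v) (cmLocalForm L 2 v)) ⧸ (cmBorelTriple L 2 v).M) × ↥(cmBorelTriple L 2 v).M |
      IsRegularElt (((p.2 : ↥(unitaryGroupOfForm (conjLocal L (IsCMField.complexConj L) v) (cmLocalForm L 2 v)))) : GL (Fin 2) (LocalRing L v))} =
      {x | ∃ g t : ↥(unitaryGroupOfForm (conjLocal L (IsCMField.complexConj L) v) (cmLocalForm L 2 v)), t ∈ (cmBorelTriple L 2 v).M ∧ IsRegularElt (t : GL (Fin 2) (LocalRing L v)) ∧ g * t * g⁻¹ = x} := by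
    ext x
    constructor
    · rintro ⟨⟨q, t⟩, ht, rfl⟩
      obtain ⟨g, rfl⟩ := QuotientGroup.mk_surjective q
      exact ⟨g, t, t.2, ht, (hΦ g t).symm⟩
    · rintro ⟨g, t, htT, ht, rfl⟩
      exact ⟨(QuotientGroup.mk g, ⟨t, htT⟩), ht, hΦ g ⟨t, htT⟩⟩
  have hΩm : MeasurableSet
      {x | ∃ g t : ↥(unitaryGroupOfForm (conjLocal L (IsCMField.complexConj L) v) (cmLocalForm L 2 v)), t ∈ (cmBorelTriple L 2 v).M ∧ IsRegularElt (t : GL (Fin 2) (LocalRing L v)) ∧ g * t * g⁻¹ = x} := by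
    rw [← hΩeq, ← Set.univ_inter {p : (↥(unitaryGroupOfForm (conjLocal L (IsCMField.complexConj L) v) (cmLocalForm L 2 v)) ⧸ (cmBorelTriple L 2 v).M) × ↥(cmBorelTriple L 2 v).M |
      IsRegularElt (((p.2 : ↥(unitaryGroupOfForm (conjLocal L (IsCMField.complexConj L) v) (cmLocalForm L 2 v)))) : GL (Fin 2) (LocalRing L v))}]
    exact measurableSet_image_inter_of_locallyInjOn hD₀ hΦc hinj MeasurableSet.univ
  -- §e ★ `exists_radialMeasure_lintegral_conjFamily` with «regular set» `R := Ω`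
  have hRTΩ : ∀ t : ↥(cmBorelTriple L 2 v).M,
      (t : ↥(unitaryGroupOfForm (conjLocal L (IsCMField.complexConj L) v) (cmLocalForm L 2 v))) ∈ {x | ∃ g t : ↥(unitaryGroupOfForm (conjLocal L (IsCMField.complexConj L) v) (cmLocalForm L 2 v)), t ∈ (cmBorelTriple L 2 v).M ∧ IsRegularElt (t : GL (Fin 2) (LocalRing L v)) ∧ g * t * g⁻¹ = x} →
      Subgroup.centralizer ({(t : ↥(unitaryGroupOfForm (conjLocal L (IsCMField.complexConj L) v) (cmLocalForm L 2 v)))} : Set ↥(unitaryGroupOfForm (conjLocal L (IsCMField.complexConj L) v) (cmLocalForm L 2 v))) = (cmBorelTriple L 2 v).M := fun t ht =>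
    centralizer_eq_torusU_of_isRegularElt (conjLocal L (IsCMField.complexConj L) v) (cmLocalForm L 2 v) t.2
      (isRegularElt_of_mem_hypSet (conjLocal L (IsCMField.complexConj L) v) (cmLocalForm L 2 v) ht)
  have hRcΩ : ∀ g x : ↥(unitaryGroupOfForm (conjLocal L (IsCMField.complexConj L) v) (cmLocalForm L 2 v)),
      x ∈ {x | ∃ g t : ↥(unitaryGroupOfForm (conjLocal L (IsCMField.complexConj L) v) (cmLocalForm L 2 v)), t ∈ (cmBorelTriple L 2 v).M ∧ IsRegularElt (t : GL (Fin 2) (LocalRing L v)) ∧ g * t * g⁻¹ = x} →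
      g * x * g⁻¹ ∈ {x | ∃ g t : ↥(unitaryGroupOfForm (conjLocal L (IsCMField.complexConj L) v) (cmLocalForm L 2 v)), t ∈ (cmBorelTriple L 2 v).M ∧ IsRegularElt (t : GL (Fin 2) (LocalRing L v)) ∧ g * t * g⁻¹ = x} :=
    fun g x hx => conj_mem_hypSet (conjLocal L (IsCMField.complexConj L) v) (cmLocalForm L 2 v) hx g
  obtain ⟨σ', hfin, hsf, hcar, hmain⟩ :=
    exists_radialMeasure_lintegral_conjFamily (cmBorelTriple L 2 v).M hT hTc ν Φ hΦ _ hΩm hRTΩ hRcΩ hW0 tm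
  have hDΩ : {p : (↥(unitaryGroupOfForm (conjLocal L (IsCMField.complexConj L) v) (cmLocalForm L 2 v)) ⧸ (cmBorelTriple L 2 v).M) × ↥(cmBorelTriple L 2 v).M | ((p.2 : ↥(cmBorelTriple L 2 v).M) : ↥(unitaryGroupOfForm (conjLocal L (IsCMField.complexConj L) v) (cmLocalForm L 2 v))) ∈
      {x | ∃ g t : ↥(unitaryGroupOfForm (conjLocal L (IsCMField.complexConj L) v) (cmLocalForm L 2 v)), t ∈ (cmBorelTriple L 2 v).M ∧ IsRegularElt (t : GL (Fin 2) (LocalRing L v)) ∧ g * t * g⁻¹ = x}} =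
      {p | IsRegularElt (((p.2 : ↥(unitaryGroupOfForm (conjLocal L (IsCMField.complexConj L) v) (cmLocalForm L 2 v)))) : GL (Fin 2) (LocalRing L v))} := by
    ext p
    exact ⟨fun h => isRegularElt_of_mem_hypSet (conjLocal L (IsCMField.complexConj L) v) (cmLocalForm L 2 v) h,
      fun h => mem_hypSet_of_mem_torusU (conjLocal L (IsCMField.complexConj L) v) (cmLocalForm L 2 v) p.2.2 h⟩
  refine ⟨σ', hfin, hsf, ?_, fun f hf => ?_⟩
  · rw [← hcar]
    congr 1
    ext t
    simp only [mem_setOf_eq]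
    exact not_congr ⟨fun h => mem_hypSet_of_mem_torusU (conjLocal L (IsCMField.complexConj L) v) (cmLocalForm L 2 v) t.2 h,
      fun h => isRegularElt_of_mem_hypSet (conjLocal L (IsCMField.complexConj L) v) (cmLocalForm L 2 v) h⟩
  · have h := hmain f hf
    rw [hW, hDΩ, hΩeq] at h
    simpa only [Nat.cast_ofNat] using h

set_option maxHeartbeats 400000 in
/-- **THE WEYL INTEGRATION FORMULA ON THE HYPERBOLIC SET — measure and Bochner forms** (same `σ` as `exists_radialMeasure_lintegral_hypSet_two`): in addition to the
`∫⁻` identity, `(σ ⊗ (ν∕tm)) ∘ Φ̃⁻¹ = 2 · ν|_Ω` as measures on `G` (`Φ̃(t, q) = Φ(q, t)`), and for every `g : G → ℂ` that is `ν`-integrable on `Ω` the integrand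
`(t, q) ↦ g(Φ(q, t))` is `σ ⊗ (ν∕tm)`-integrable with **`∫_T ∫_{G ⧸ T} g(Φ(q, t)) d(ν∕tm) dσ = 2 • ∫_Ω g dν`** — i.e. `∫_Ω g = ½ ∫_T (∫_{G⧸T} g(x t x⁻¹) dẋ) dσ(t)`,
the shape the (PSM★)∕(WM)∕(HM) road integrates against van Dijk's torus form. [cite: Rogawski1990, §12.5 p. 182] [cite: HarishChandra1970, Lemma 42]
[cite: vanDijk1972, §2] -/
theorem exists_radialMeasure_integral_hypSet_two
    (hns : ∀ w : PlacesOver L v, IsCMField.complexConj L • w.1 = w.1)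
    [MeasurableSpace ↥(unitaryGroupOfForm (conjLocal L (IsCMField.complexConj L) v) (cmLocalForm L 2 v))]
    [BorelSpace ↥(unitaryGroupOfForm (conjLocal L (IsCMField.complexConj L) v) (cmLocalForm L 2 v))]
    [LocallyCompactSpace ↥(unitaryGroupOfForm (conjLocal L (IsCMField.complexConj L) v) (cmLocalForm L 2 v))]
    [SecondCountableTopology ↥(unitaryGroupOfForm (conjLocal L (IsCMField.complexConj L) v) (cmLocalForm L 2 v))]
    [T2Space ↥(unitaryGroupOfForm (conjLocal L (IsCMField.complexConj L) v) (cmLocalForm L 2 v))]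
    [MeasurableSpace (↥(unitaryGroupOfForm (conjLocal L (IsCMField.complexConj L) v) (cmLocalForm L 2 v)) ⧸ (cmBorelTriple L 2 v).M)]
    [BorelSpace (↥(unitaryGroupOfForm (conjLocal L (IsCMField.complexConj L) v) (cmLocalForm L 2 v)) ⧸ (cmBorelTriple L 2 v).M)]
    (ν : Measure ↥(unitaryGroupOfForm (conjLocal L (IsCMField.complexConj L) v) (cmLocalForm L 2 v)))
    [ν.IsHaarMeasure] [ν.IsMulRightInvariant]
    (tm : Measure ↥(cmBorelTriple L 2 v).M) [tm.IsMulLeftInvariant] [IsFiniteMeasureOnCompacts tm] [tm.IsOpenPosMeasure]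
    [tm.IsInvInvariant]
    (Φ : (↥(unitaryGroupOfForm (conjLocal L (IsCMField.complexConj L) v) (cmLocalForm L 2 v)) ⧸ (cmBorelTriple L 2 v).M) × ↥(cmBorelTriple L 2 v).M → ↥(unitaryGroupOfForm (conjLocal L (IsCMField.complexConj L) v) (cmLocalForm L 2 v)))
    (hΦ : ∀ (x : ↥(unitaryGroupOfForm (conjLocal L (IsCMField.complexConj L) v) (cmLocalForm L 2 v))) (t : ↥(cmBorelTriple L 2 v).M), Φ (QuotientGroup.mk x, t) = x * t * x⁻¹) :
    ∃ σ : Measure ↥(cmBorelTriple L 2 v).M, IsFiniteMeasureOnCompacts σ ∧ SigmaFinite σ ∧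
      σ {t : ↥(cmBorelTriple L 2 v).M | ¬ IsRegularElt (((t : ↥(unitaryGroupOfForm (conjLocal L (IsCMField.complexConj L) v) (cmLocalForm L 2 v)))) : GL (Fin 2) (LocalRing L v))} = 0 ∧
      (∀ f : ↥(unitaryGroupOfForm (conjLocal L (IsCMField.complexConj L) v) (cmLocalForm L 2 v)) → ℝ≥0∞, Measurable f →
        2 * ∫⁻ y in {x | ∃ g t : ↥(unitaryGroupOfForm (conjLocal L (IsCMField.complexConj L) v) (cmLocalForm L 2 v)), t ∈ (cmBorelTriple L 2 v).M ∧ IsRegularElt (t : GL (Fin 2) (LocalRing L v)) ∧ g * t * g⁻¹ = x}, f y ∂ν =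
          ∫⁻ t, ∫⁻ q, f (Φ (q, t)) ∂(quotientMeasure (cmBorelTriple L 2 v).M tm (isClosed_cmBorelTriple_M_two L v) ν) ∂σ) ∧
      (σ.prod (quotientMeasure (cmBorelTriple L 2 v).M tm (isClosed_cmBorelTriple_M_two L v) ν)).map (fun p => Φ (p.2, p.1)) =
        (2 : ℝ≥0∞) • ν.restrict {x | ∃ g t : ↥(unitaryGroupOfForm (conjLocal L (IsCMField.complexConj L) v) (cmLocalForm L 2 v)), t ∈ (cmBorelTriple L 2 v).M ∧ IsRegularElt (t : GL (Fin 2) (LocalRing L v)) ∧ g * t * g⁻¹ = x} ∧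
      ∀ g : ↥(unitaryGroupOfForm (conjLocal L (IsCMField.complexConj L) v) (cmLocalForm L 2 v)) → ℂ,
        IntegrableOn g {x | ∃ g t : ↥(unitaryGroupOfForm (conjLocal L (IsCMField.complexConj L) v) (cmLocalForm L 2 v)), t ∈ (cmBorelTriple L 2 v).M ∧ IsRegularElt (t : GL (Fin 2) (LocalRing L v)) ∧ g * t * g⁻¹ = x} ν →
        Integrable (fun p : ↥(cmBorelTriple L 2 v).M × (↥(unitaryGroupOfForm (conjLocal L (IsCMField.complexConj L) v) (cmLocalForm L 2 v)) ⧸ (cmBorelTriple L 2 v).M) => g (Φ (p.2, p.1)))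
            (σ.prod (quotientMeasure (cmBorelTriple L 2 v).M tm (isClosed_cmBorelTriple_M_two L v) ν)) ∧
          ∫ t, ∫ q, g (Φ (q, t)) ∂(quotientMeasure (cmBorelTriple L 2 v).M tm (isClosed_cmBorelTriple_M_two L v) ν) ∂σ =
            (2 : ℝ) • ∫ y in {x | ∃ g t : ↥(unitaryGroupOfForm (conjLocal L (IsCMField.complexConj L) v) (cmLocalForm L 2 v)), t ∈ (cmBorelTriple L 2 v).M ∧ IsRegularElt (t : GL (Fin 2) (LocalRing L v)) ∧ g * t * g⁻¹ = x}, g y ∂ν := by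
  obtain ⟨σ', hfin, hsf, hcar, hmain⟩ := exists_radialMeasure_lintegral_hypSet_two L v hns ν tm Φ hΦ
  haveI := hsf
  haveI : SecondCountableTopology (↥(unitaryGroupOfForm (conjLocal L (IsCMField.complexConj L) v) (cmLocalForm L 2 v)) ⧸ (cmBorelTriple L 2 v).M) :=
    (QuotientGroup.isQuotientMap_mk _).secondCountableTopology QuotientGroup.isOpenMap_coe
  haveI : LocallyCompactSpace (↥(unitaryGroupOfForm (conjLocal L (IsCMField.complexConj L) v) (cmLocalForm L 2 v)) ⧸ (cmBorelTriple L 2 v).M) := QuotientGroup.instLocallyCompactSpace _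
  haveI : SigmaCompactSpace (↥(unitaryGroupOfForm (conjLocal L (IsCMField.complexConj L) v) (cmLocalForm L 2 v)) ⧸ (cmBorelTriple L 2 v).M) := sigmaCompactSpace_of_locallyCompact_secondCountable
  haveI : SigmaFinite (quotientMeasure (cmBorelTriple L 2 v).M tm (isClosed_cmBorelTriple_M_two L v) ν) :=
    SigmaFinite.of_isFiniteMeasureOnCompacts _
  haveI : SecondCountableTopology ↥(cmBorelTriple L 2 v).M := TopologicalSpace.Subtype.secondCountableTopology _
  haveI : BorelSpace ((↥(unitaryGroupOfForm (conjLocal L (IsCMField.complexConj L) v) (cmLocalForm L 2 v)) ⧸ (cmBorelTriple L 2 v).M) × ↥(cmBorelTriple L 2 v).M) := Prod.borelSpace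
  have hΦm : Measurable Φ := (continuous_conjFamily_and_smul (cmBorelTriple L 2 v).M Φ hΦ).1.measurable
  have hmain' : ∀ f : ↥(unitaryGroupOfForm (conjLocal L (IsCMField.complexConj L) v) (cmLocalForm L 2 v)) → ℝ≥0∞, Measurable f →
      ((2 : ℕ) : ℝ≥0∞) * ∫⁻ y in {x | ∃ g t : ↥(unitaryGroupOfForm (conjLocal L (IsCMField.complexConj L) v) (cmLocalForm L 2 v)), t ∈ (cmBorelTriple L 2 v).M ∧ IsRegularElt (t : GL (Fin 2) (LocalRing L v)) ∧ g * t * g⁻¹ = x}, f y ∂ν =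
        ∫⁻ t, ∫⁻ q, f (Φ (q, t)) ∂(quotientMeasure (cmBorelTriple L 2 v).M tm (isClosed_cmBorelTriple_M_two L v) ν) ∂σ' :=
    fun f hf => by rw [Nat.cast_ofNat]; exact hmain f hf
  refine ⟨σ', hfin, hsf, hcar, hmain, ?_, fun g hg => ?_⟩
  · simpa only [Nat.cast_ofNat] using map_prod_eq_smul_restrict_of_lintegral_radial hΦm hmain'
  · simpa only [Nat.cast_ofNat] using integrable_and_integral_eq_smul_of_lintegral_radial hΦm hmain' g hg


end Summit.HodgeConjecture.HodgeConjecture.Cruxes.H413.K2E3QuasiSplitTwoWeylRadial
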